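import Literature.Geometry.Lorentzian.CauchyProblemLocalUniquenessProofs
import Literature.Analysis.PDE.QuasilinearHyperbolicUniqueness
import HarnessLib

/-!
# Local geometric uniqueness of vacuum developments from the reduced equations in wave slice charts

Third support file (everything proved, no named facts) for the named fact
`Literature.Geometry.Lorentzian.hawkingEllis_locallyUnique_vacuumDevelopment` (Hawking–Ellis
1973, §7.5, the local Cauchy development theorem: two vacuum developments of the same data are
extensions of a common one). It joins the two halves of the tree's proof:

* the **manifold half** (`CauchyProblemLocalUniquenessProofs.lean`, `LocalCauchyLens.lean`): the
  fact follows from *matching slice charts* — charts `Φ`, `Φ'` of the two developments about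
  `ι₁ x`, `ι₂ x`, built from one chart of the data manifold, in which the coordinate expressions
  `Φ⁻¹* g₁`, `Φ'⁻¹* g₂` of the two metrics agree near the common base point
  (`hawkingEllis_locallyUnique_vacuumDevelopment_of_matchingCharts`);
* the **PDE half** (`Literature/Analysis/PDE/SecondOrderHyperbolicUniqueness.lean`,
  `QuasilinearHyperbolicUniqueness.lean`): two solutions of a quasilinear diagonal second-order
  hyperbolic system with the same Cauchy data agree near the base point
  (`VarWave.eventually_eq_of_quasilinear_germ`, the uniqueness clause of Hawking–Ellis'
  Prop. 7.5.1 in classical form).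

Here the time coordinate is split off, `ℝ⁴ ≃ ℝ × ℝ³` (`coordSplit`), the coordinate metrics are
read through their `16` components (`bilinComps`, injective: `bilinComps_injective`), and
**`hawkingEllis_locallyUnique_vacuumDevelopment_of_reducedEquations`** proves the fact from the
statement that remains analytic: about every point of the data there are slice charts of the two
developments, agreeing along the data, in which the component functions of the two coordinate
metrics solve, near the base point, one and the same quasilinear diagonal second-order system,
hyperbolic at the base point, with the same Cauchy data on the slice `{t = 0}` — in the source these
are the harmonic coordinates (7.51) of the two developments built from the same coordinates of `𝒮`,
in which both metrics solve the reduced empty space Einstein equations (7.44)–(7.46) with the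
initial data determined by `(h, χ)` (§7.5, p. 248–249). What is *not* proved in the tree is thus
exactly: the existence of such harmonic slice charts (local existence for the wave equation (7.51),
Prop. 7.4.7), the reduced Einstein equations in them, and the determination of the first jets of
the coordinate metric by the data.

## References

* S. W. Hawking, G. F. R. Ellis, *The large scale structure of space-time*, CUP 1973, §7.4
  (Prop. 7.4.5, Prop. 7.4.7), §7.5 (Prop. 7.5.1, pp. 248–249). [HawkingEllis1973CUP]
* J. Sbierski, *On the existence of a maximal Cauchy development for the Einstein equations*,
  Ann. Henri Poincaré 17 (2016), Thm. 2.4 (ii), Def. 2.3. [Sbierski2016AHP]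
-/

noncomputable section

open Bundle Set Function Filter TopologicalSpace Topology Manifold
open scoped Manifold ContDiff Topology RealInnerProductSpace

namespace Literature.Geometry.Lorentzian

universe u

/-! ### Splitting off the time coordinate; components of bilinear forms -/

section Split

variable (n : ℕ)

/-- `ℝ^{n+1} ≃ ℝ × ℝⁿ`, `f ↦ (f 0, f ∘ succ)`, as a linear equivalence of function spaces.
[folklore] -/
def finSuccSplit : (Fin (n + 1) → ℝ) ≃ₗ[ℝ] ℝ × (Fin n → ℝ) where
  toFun f := (f 0, fun i ↦ f i.succ)
  invFun p := Fin.cons p.1 p.2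
  map_add' _ _ := rfl
  map_smul' _ _ := rfl
  left_inv f := Fin.cons_self_tail f
  right_inv p := by ext <;> simp

/-- **Splitting off the time coordinate**: the continuous linear equivalence
`EuclideanSpace ℝ (Fin (n+1)) ≃ ℝ × EuclideanSpace ℝ (Fin n)`, `p ↦ (p 0, (p 1, …, p n))`.
[folklore] -/
def coordSplit : EuclideanSpace ℝ (Fin (n + 1)) ≃L[ℝ] ℝ × EuclideanSpace ℝ (Fin n) :=
  ((WithLp.linearEquiv 2 ℝ (Fin (n + 1) → ℝ)).trans ((finSuccSplit n).trans
    (LinearEquiv.prodCongr (LinearEquiv.refl ℝ ℝ)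
      (WithLp.linearEquiv 2 ℝ (Fin n → ℝ)).symm))).toContinuousLinearEquiv

/-- `coordSplit p = (p 0, (p 1, …, p n))`. [folklore] -/
theorem coordSplit_apply (p : EuclideanSpace ℝ (Fin (n + 1))) :
    coordSplit n p = (p 0, WithLp.toLp 2 fun i ↦ p i.succ) := rfl

/-- The first component of `coordSplit p` is the time coordinate `p 0`. [folklore] -/
theorem coordSplit_apply_fst (p : EuclideanSpace ℝ (Fin (n + 1))) : (coordSplit n p).1 = p 0 := rfl

variable {n}

/-- **Components of a bilinear form** on `EuclideanSpace ℝ (Fin m)` in the standard basis, as a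
continuous linear map into `EuclideanSpace ℝ (Fin m × Fin m)`. [folklore] -/
def bilinComps (m : ℕ) :
    (EuclideanSpace ℝ (Fin m) →L[ℝ] EuclideanSpace ℝ (Fin m) →L[ℝ] ℝ) →L[ℝ]
      EuclideanSpace ℝ (Fin m × Fin m) :=
  (EuclideanSpace.equiv (Fin m × Fin m) ℝ).symm.toContinuousLinearMap.comp
    (ContinuousLinearMap.pi fun ab : Fin m × Fin m ↦
      (ContinuousLinearMap.apply ℝ ℝ (EuclideanSpace.single ab.2 (1 : ℝ))).comp
        (ContinuousLinearMap.apply ℝ (EuclideanSpace ℝ (Fin m) →L[ℝ] ℝ)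
          (EuclideanSpace.single ab.1 (1 : ℝ))))

/-- `bilinComps B (a, b) = B(e_a, e_b)`. [folklore] -/
theorem bilinComps_apply {m : ℕ}
    (B : EuclideanSpace ℝ (Fin m) →L[ℝ] EuclideanSpace ℝ (Fin m) →L[ℝ] ℝ) (a b : Fin m) :
    bilinComps m B (a, b) = B (EuclideanSpace.single a 1) (EuclideanSpace.single b 1) := by
  simp [bilinComps]

/-- **A bilinear form is determined by its components.** [folklore] -/
theorem bilinComps_injective (m : ℕ) : Function.Injective (bilinComps m) := by
  intro B B' h
  have hab : ∀ a b, B (EuclideanSpace.single a 1) (EuclideanSpace.single b 1) =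
      B' (EuclideanSpace.single a 1) (EuclideanSpace.single b 1) := fun a b ↦ by
    rw [← bilinComps_apply, ← bilinComps_apply, h]
  refine ContinuousLinearMap.coe_injective
    ((EuclideanSpace.basisFun (Fin m) ℝ).toBasis.ext fun a ↦ ?_)
  refine ContinuousLinearMap.coe_injective
    ((EuclideanSpace.basisFun (Fin m) ℝ).toBasis.ext fun b ↦ ?_)
  simp only [OrthonormalBasis.coe_toBasis, EuclideanSpace.basisFun_apply, ContinuousLinearMap.coe_coe]
  exact hab a b

end Split

/-! ### Matching of coordinate metrics from the agreement of their component functions -/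

section Matching

variable {n : ℕ} {X : Type u} [TopologicalSpace X] [ChartedSpace (EuclideanSpace ℝ (Fin n)) X]
  [IsManifold (𝓡 n) ∞ X] [ConnectedSpace X] {D : InitialDataSet (𝓡 n) X}

namespace CauchyDevelopment

/-- The `(n+1)²` **component functions of a coordinate metric** `Φ⁻¹* g` of a data embedding in a
chart `Φ`, as a function of `(t, x⃗) ∈ ℝ × ℝⁿ` (time coordinate split off). [folklore] -/
def coordMetricComps (𝒮 : DataEmbedding D)
    (Φ : OpenPartialHomeomorph 𝒮.carrier (EuclideanSpace ℝ (Fin (n + 1))))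
    (q : ℝ × EuclideanSpace ℝ (Fin n)) : EuclideanSpace ℝ (Fin (n + 1) × Fin (n + 1)) :=
  bilinComps (n + 1)
    (pullbackBilin (I := 𝓡 (n + 1)) (I' := 𝓡 (n + 1)) Φ.symm 𝒮.metric.val ((coordSplit n).symm q))

/-- **Matching charts from matching component functions.** If the component functions of the
coordinate metrics of `𝒟` in `Φ` and of `𝒮'` in `Φ'` agree near `coordSplit (Φ (ι x))`, and
`Φ (ι x) = Φ' (ι' x)`, then the two coordinate metrics agree near `Φ (ι x)` (hypothesis `hmatch`
of `exists_germ_of_matchingCharts`). [folklore] -/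
theorem eventually_match_of_coordMetricComps (𝒟 : CauchyDevelopment D) (𝒮' : DataEmbedding D)
    (x : X) {Φ : OpenPartialHomeomorph 𝒟.carrier (EuclideanSpace ℝ (Fin (n + 1)))}
    {Φ' : OpenPartialHomeomorph 𝒮'.carrier (EuclideanSpace ℝ (Fin (n + 1)))}
    (hxΦ : 𝒟.embed x ∈ Φ.source) (hxΦ' : 𝒮'.embed x ∈ Φ'.source)
    (hbase : Φ (𝒟.embed x) = Φ' (𝒮'.embed x))
    (heq : ∀ᶠ q in 𝓝 (coordSplit n (Φ (𝒟.embed x))),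
      coordMetricComps 𝒟.toDataEmbedding Φ q = coordMetricComps 𝒮' Φ' q) :
    ∀ᶠ p in 𝓝 (Φ (𝒟.embed x)), p ∈ Φ.target ∧ p ∈ Φ'.target ∧
      pullbackBilin (I := 𝓡 (n + 1)) (I' := 𝓡 (n + 1)) Φ.symm 𝒟.metric.val p =
        pullbackBilin (I := 𝓡 (n + 1)) (I' := 𝓡 (n + 1)) Φ'.symm 𝒮'.metric.val p := by
  have ht : Φ.target ∈ 𝓝 (Φ (𝒟.embed x)) := Φ.open_target.mem_nhds (Φ.map_source hxΦ)
  have ht' : Φ'.target ∈ 𝓝 (Φ (𝒟.embed x)) := by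
    rw [hbase]; exact Φ'.open_target.mem_nhds (Φ'.map_source hxΦ')
  have heq' := (coordSplit n).continuous.continuousAt.eventually heq
  filter_upwards [ht, ht', heq'] with p hp hp' he
  refine ⟨hp, hp', bilinComps_injective (n + 1) ?_⟩
  have hp0 : (coordSplit n).symm (coordSplit n p) = p := (coordSplit n).symm_apply_apply p
  have h := he
  simp only [coordMetricComps] at h
  rw [hp0] at h
  exact h

end CauchyDevelopment

end Matching

/-! ### The named fact from the reduced equations in wave slice charts -/

/-- **`hawkingEllis_locallyUnique_vacuumDevelopment` from the reduced equations in wave slice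
charts.** Hawking–Ellis' local Cauchy development theorem (1973, §7.5, pp. 247–249; Sbierski 2016,
Thm. 2.4 (ii)) proved from the following coordinate statement of its analytic core (hypothesis
`hre`): for any two vacuum Cauchy developments `𝒟₁`, `𝒟₂` of the same data on `X` and every
`x ∈ X` there are charts `Φ`, `Φ'` of the maximal atlases of the two spacetimes which *agree along
the data* near `x` (`Φ ∘ ι₁ = Φ' ∘ ι₂`, time coordinate `0` on the data, its zero set near `ι₁ x`
on `ι₁(X)`, increasing along the future unit normals) and in which the **component functions**
`u₁ = (Φ⁻¹* g₁)_{ab} ∘ coordSplit⁻¹`, `u₂ = (Φ'⁻¹* g₂)_{ab} ∘ coordSplit⁻¹` on `ℝ × ℝ³` are smooth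
near the base point `(0, x₁) = coordSplit (Φ (ι₁ x))` and solve there one and the same quasilinear
diagonal second-order system `𝔞(p,u) u_tt − 2 ∑ 𝔟ⁱ(p,u) u_ti − ∑ 𝔊ⁱʲ(p,u) u_ij = 𝔑(p, u, u_t, ∇u)`
with coefficients smooth near the base jets, hyperbolic at the base jet (`𝔞 > 0`, `𝔊 ≥ λ > 0`),
and with the same Cauchy data `u₁(0, ·) = u₂(0, ·)`, `∂ₜu₁(0, ·) = ∂ₜu₂(0, ·)` near `x₁` — in the
source: harmonic coordinates (7.51) built from the same coordinates of `𝒮`, in which both metrics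
solve the reduced empty space Einstein equations (7.44)–(7.46) with the initial data determined by
`(h, χ)`. Then the two developments are extensions of a common one: the coordinate metrics agree
near the base point (`VarWave.eventually_eq_of_quasilinear_germ`, Prop. 7.5.1 uniqueness, and
`CauchyDevelopment.eventually_match_of_coordMetricComps`), so the charts match and
`hawkingEllis_locallyUnique_vacuumDevelopment_of_matchingCharts` applies.
[cite: HawkingEllis1973CUP, §7.5, pp. 247–249, Prop. 7.5.1] [cite: Sbierski2016AHP, Thm. 2.4 (ii) and Def. 2.3] -/
theorem hawkingEllis_locallyUnique_vacuumDevelopment_of_reducedEquations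
    (hre : ∀ (X : Type) [TopologicalSpace X] [ChartedSpace (EuclideanSpace ℝ (Fin 3)) X]
      [IsManifold (𝓡 3) ∞ X] [T2Space X] [SecondCountableTopology X] [ConnectedSpace X]
      (D : InitialDataSet (𝓡 3) X) (𝒟₁ 𝒟₂ : VacuumCauchyDevelopment D) (x : X),
      ∃ (Φ : OpenPartialHomeomorph 𝒟₁.carrier (EuclideanSpace ℝ (Fin 4)))
        (Φ' : OpenPartialHomeomorph 𝒟₂.carrier (EuclideanSpace ℝ (Fin 4))),
        Φ ∈ IsManifold.maximalAtlas (𝓡 4) ∞ 𝒟₁.carrier ∧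
        Φ' ∈ IsManifold.maximalAtlas (𝓡 4) ∞ 𝒟₂.carrier ∧
        (∀ᶠ y in 𝓝 x, 𝒟₁.embed y ∈ Φ.source ∧ 𝒟₂.embed y ∈ Φ'.source ∧
          Φ (𝒟₁.embed y) = Φ' (𝒟₂.embed y) ∧ Φ (𝒟₁.embed y) 0 = 0) ∧
        (∀ᶠ q in 𝓝 (𝒟₁.embed x), Φ q 0 = 0 → q ∈ range 𝒟₁.embed) ∧
        0 < EuclideanSpace.proj (0 : Fin 4) (mfderiv (𝓡 4) (𝓡 4) Φ (𝒟₁.embed x) (𝒟₁.normal x)) ∧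
        0 < EuclideanSpace.proj (0 : Fin 4)
          (mfderiv (𝓡 4) (𝓡 4) Φ' (𝒟₂.embed x) (𝒟₂.normal x)) ∧
        -- the reduced equations for the component functions of the two coordinate metrics
        ∃ (𝔞 : (ℝ × EuclideanSpace ℝ (Fin 3)) × EuclideanSpace ℝ (Fin 4 × Fin 4) → ℝ)
          (𝔟 : Fin 3 → (ℝ × EuclideanSpace ℝ (Fin 3)) × EuclideanSpace ℝ (Fin 4 × Fin 4) → ℝ)
          (𝔊 : Fin 3 → Fin 3 →
            (ℝ × EuclideanSpace ℝ (Fin 3)) × EuclideanSpace ℝ (Fin 4 × Fin 4) → ℝ)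
          (𝔑 : (ℝ × EuclideanSpace ℝ (Fin 3)) × EuclideanSpace ℝ (Fin 4 × Fin 4) ×
            EuclideanSpace ℝ (Fin 4 × Fin 4) × (Fin 3 → EuclideanSpace ℝ (Fin 4 × Fin 4)) →
              EuclideanSpace ℝ (Fin 4 × Fin 4))
          (Ω₁ : Set ((ℝ × EuclideanSpace ℝ (Fin 3)) × EuclideanSpace ℝ (Fin 4 × Fin 4)))
          (Ω₂ : Set ((ℝ × EuclideanSpace ℝ (Fin 3)) × EuclideanSpace ℝ (Fin 4 × Fin 4) ×
            EuclideanSpace ℝ (Fin 4 × Fin 4) × (Fin 3 → EuclideanSpace ℝ (Fin 4 × Fin 4))))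
          (U : Set (ℝ × EuclideanSpace ℝ (Fin 3))) (lam : ℝ) (x₁ : EuclideanSpace ℝ (Fin 3)),
          coordSplit 3 (Φ (𝒟₁.embed x)) = ((0 : ℝ), x₁) ∧
          IsOpen Ω₁ ∧ IsOpen Ω₂ ∧ ContDiffOn ℝ ∞ 𝔞 Ω₁ ∧ (∀ i, ContDiffOn ℝ ∞ (𝔟 i) Ω₁) ∧
          (∀ i j, ContDiffOn ℝ ∞ (𝔊 i j) Ω₁) ∧ (∀ i j q, 𝔊 i j q = 𝔊 j i q) ∧
          ContDiffOn ℝ ∞ 𝔑 Ω₂ ∧ U ∈ 𝓝 ((0 : ℝ), x₁) ∧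
          ContDiffOn ℝ ∞ (CauchyDevelopment.coordMetricComps 𝒟₁.toDataEmbedding Φ) U ∧
          ContDiffOn ℝ ∞ (CauchyDevelopment.coordMetricComps 𝒟₂.toDataEmbedding Φ') U ∧
          (((0 : ℝ), x₁), CauchyDevelopment.coordMetricComps 𝒟₁.toDataEmbedding Φ (0, x₁)) ∈ Ω₁ ∧
          (((0 : ℝ), x₁), CauchyDevelopment.coordMetricComps 𝒟₁.toDataEmbedding Φ (0, x₁),
            Literature.Analysis.PDE.VarWave.dT
              (CauchyDevelopment.coordMetricComps 𝒟₁.toDataEmbedding Φ) (0, x₁),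
            fun i ↦ Literature.Analysis.PDE.VarWave.dX
              (CauchyDevelopment.coordMetricComps 𝒟₁.toDataEmbedding Φ) i (0, x₁)) ∈ Ω₂ ∧
          0 < 𝔞 ((0, x₁), CauchyDevelopment.coordMetricComps 𝒟₁.toDataEmbedding Φ (0, x₁)) ∧
          0 < lam ∧
          (∀ Y : Fin 3 → EuclideanSpace ℝ (Fin 4 × Fin 4), lam * ∑ i, ‖Y i‖ ^ 2 ≤
            ∑ i, ∑ j, 𝔊 i j ((0, x₁),
              CauchyDevelopment.coordMetricComps 𝒟₁.toDataEmbedding Φ (0, x₁)) * ⟪Y i, Y j⟫) ∧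
          (∀ᶠ p in 𝓝 ((0 : ℝ), x₁),
            Literature.Analysis.PDE.VarWave.op (CauchyDevelopment.coordMetricComps 𝒟₁.toDataEmbedding Φ)
                (fun q ↦ 𝔞 (q, CauchyDevelopment.coordMetricComps 𝒟₁.toDataEmbedding Φ q))
                (fun i q ↦ 𝔟 i (q, CauchyDevelopment.coordMetricComps 𝒟₁.toDataEmbedding Φ q))
                (fun i j q ↦ 𝔊 i j (q, CauchyDevelopment.coordMetricComps 𝒟₁.toDataEmbedding Φ q)) p =
              𝔑 (p, CauchyDevelopment.coordMetricComps 𝒟₁.toDataEmbedding Φ p,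
                Literature.Analysis.PDE.VarWave.dT
                  (CauchyDevelopment.coordMetricComps 𝒟₁.toDataEmbedding Φ) p,
                fun i ↦ Literature.Analysis.PDE.VarWave.dX
                  (CauchyDevelopment.coordMetricComps 𝒟₁.toDataEmbedding Φ) i p)) ∧
          (∀ᶠ p in 𝓝 ((0 : ℝ), x₁),
            Literature.Analysis.PDE.VarWave.op (CauchyDevelopment.coordMetricComps 𝒟₂.toDataEmbedding Φ')
                (fun q ↦ 𝔞 (q, CauchyDevelopment.coordMetricComps 𝒟₂.toDataEmbedding Φ' q))
                (fun i q ↦ 𝔟 i (q, CauchyDevelopment.coordMetricComps 𝒟₂.toDataEmbedding Φ' q))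
                (fun i j q ↦ 𝔊 i j (q, CauchyDevelopment.coordMetricComps 𝒟₂.toDataEmbedding Φ' q)) p =
              𝔑 (p, CauchyDevelopment.coordMetricComps 𝒟₂.toDataEmbedding Φ' p,
                Literature.Analysis.PDE.VarWave.dT
                  (CauchyDevelopment.coordMetricComps 𝒟₂.toDataEmbedding Φ') p,
                fun i ↦ Literature.Analysis.PDE.VarWave.dX
                  (CauchyDevelopment.coordMetricComps 𝒟₂.toDataEmbedding Φ') i p)) ∧
          (∀ᶠ y in 𝓝 x₁, CauchyDevelopment.coordMetricComps 𝒟₁.toDataEmbedding Φ (0, y) =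
            CauchyDevelopment.coordMetricComps 𝒟₂.toDataEmbedding Φ' (0, y)) ∧
          (∀ᶠ y in 𝓝 x₁,
            Literature.Analysis.PDE.VarWave.dT (CauchyDevelopment.coordMetricComps 𝒟₁.toDataEmbedding Φ) (0, y) =
              Literature.Analysis.PDE.VarWave.dT
                (CauchyDevelopment.coordMetricComps 𝒟₂.toDataEmbedding Φ') (0, y))) :
    hawkingEllis_locallyUnique_vacuumDevelopment := by
  refine hawkingEllis_locallyUnique_vacuumDevelopment_of_matchingCharts
    fun X _ _ _ _ _ _ D 𝒟₁ 𝒟₂ x ↦ ?_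
  obtain ⟨Φ, Φ', hΦ, hΦ', hdata, hslice, hν, hν', 𝔞, 𝔟, 𝔊, 𝔑, Ω₁, Ω₂, U, lam, x₁, hx₁, hΩ₁, hΩ₂,
    h𝔞, h𝔟, h𝔊, h𝔊s, h𝔑, hU, hu₁, hu₂, hm₁, hm₂, hapos, hlam, hGpos, h₁, h₂, h0, h1⟩ :=
    hre X D 𝒟₁ 𝒟₂ x
  refine ⟨Φ, Φ', hΦ, hΦ', hdata, hslice, hν, hν', ?_⟩
  obtain ⟨hxΦ, hxΦ', hbase, -⟩ := hdata.self_of_nhds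
  have heq := Literature.Analysis.PDE.VarWave.eventually_eq_of_quasilinear_germ hΩ₁ hΩ₂ h𝔞 h𝔟 h𝔊
    h𝔊s h𝔑 hU hu₁ hu₂ hm₁ hm₂ hapos hlam hGpos h₁ h₂ h0 h1
  rw [← hx₁] at heq
  exact 𝒟₁.toCauchyDevelopment.eventually_match_of_coordMetricComps 𝒟₂.toDataEmbedding x hxΦ hxΦ'
    hbase heq

end Literature.Geometry.Lorentzian
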